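import Literature.MathematicalPhysics.QuantumFieldTheory.Balaban1983to89.T3LowerAlongMinimisersSplit
import HarnessLib

/-!
# `Balaban1983to89.T3UpperAlongMinimisersSplit` — rung R3, crux K1, child «MinimiserStabilityRegPr», stub UPPER
# (`UpperAlongRegPrMinimisersAt`, cell gap G-K1a-2 «INTERP along minimisers», the HARDEST stub): the competitor SPECIFIED (an exact
# one-step regular lift of print's run-`K` minimiser costing `1/L` of its action), the stub SPLIT into [Balaban1985Variational] Prop 8
# (minimisers lie in (8)) ∧ ONE located statement `RegularLiftAlongMinimisersAt`, the composition PROVED under the route's prefix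

Cell `ym3-torus` (HUMAN RULING D-0037, YM ladder rung R3), seat `ym3-torus-p1` gen 6 (UV side); cell record HOME/UV3-NODE.md §14; sibling of
`T3LowerAlongMinimisersSplit`.  WHAT THIS IS NOT: no estimate and NOT a proof of the stub; the analytic content is ONE hypothesis schema
(`RegularLiftAlongMinimisersAt`, never asserted); what is PROVED is the fibre identity of a one-step lift (tree
`T3DescentFibreTower.mem_fibre_trans`), the use of [Balaban1985Variational] Prop 8 to put the stub's minimiser in (8), the thresholds, and
the composition into `T3PrintedRegularMinimiserReduction.UpperAlongRegPrMinimisersAt`.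

THE POINT.  `UpperAlongRegPrMinimisersAt F γ b₀ p₀ m ε₀` asks: eventually in `K`, for every `θBal(⌊K/m⌋)`-small datum `V` and every minimiser
`U` of the Wilson action over print's regular fibre (6) of run `K` over `V`, SOME printed-regular run-`(K+1)` configuration `U″` in the fibre
of `V` with `β_{K+1}A(U″) ≤ β_K A(U) + r_K`, `Σ r_K < ∞`.  Since `β_{K+1} = Lβ_K` (`T3LowerAlongMinimisersSplit.scheme_β_succ`) this reads
`L·A_{K+1}(U″) ≤ A_K(U) + r_K/β_K`: the competitor must carry `1/L = L^{−(4−d)}` of the coarse action — the continuum scaling of a SMOOTH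
interpolation (spread each coarse plaquette's curvature `φ` uniformly over the `L³` fine plaquettes of its cell: `L³·(φ/L²)²/2 = φ²/(2L)`),
NOT of the tree's exact section `faceSec` (`A(faceSec V) = L^{d−2}A(V) = L·A(V)`, `BlockAveragingSectionAction.wilsonAction4_faceSec`, a
factor `L²` too expensive after the `β`-weighting; `T3SectionAction.minAction_succ_le_mul` is that a-priori bound).  The competitor of
record is therefore an EXACT ONE-STEP REGULAR LIFT: `D_{K,K+1}U″ = U` (then `U″` lies in the `(n,K+1)`-fibre of `V` by the descent tower,
PROVED), `U″ ∈ 𝔘_{K+1−n}(ε₀)` in full (BOTH clauses at the FINER cut-off — plan g8 (v)(a): possible because `U` sits in (8), radius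
`B₃θ → 0`, so `C·L·B₃θ ≤ ε₀` eventually), and `L·A(U″) ≤ A(U) + (summable)/β_K`.  Print status (cell memo §11.3 G-K1a-2): UNPRINTED as an
inequality for non-abelian fields — [King1986] App. (A.5) has it for the abelian Higgs model because the minimiser is linear and both
Gaussian actions discretise one continuum form; the architecture «smooth interpolation + exact correction of the nonlinear average by the
right inverse of its linearisation» has its pieces in print ([Balaban1985Averaging] Props 3–4, (125); ['t Hooft 95 / Hernández–Sundrum 95]
interpolations) but no printed statement; the errors (variation of neighbouring plaquettes `Θ_K(U) = O(|∇F|²)`, commutators `O(F³)`,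
`1 − cos` vs quadratic `O(F⁴)`) are summable along the printed minimiser by its regularity (9)–(10) p. 279 iff `m ≥ 3`
(`β_K·C·Θ_K(U_k) ≲ C·B₃²M²b₀²p(g_n)²·L^{K(5/m−2)}`).
* schema **`RegularLiftAlongMinimisersAt F γ b₀ p₀ m ε₀ B₃`** (located gap G-K1a-2, never asserted): eventually in `K`, every minimiser `U`
  of (5) over (6)_K lying in (8)_K (radius `B₃θBal(⌊K/m⌋)`) has an exact one-step lift `U″` (`D_{K,K+1}U″ = U`), printed-regular at run
  `K+1`'s cut-off with radius `ε₀`, with `β_{K+1}A(U″) ≤ β_K A(U) + r_K`, `Σ r_K < ∞`;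
* **`upperAlongRegPrMinimisersAt_of_split`** (PROVED): `MinimisersIn8At L a₀ a₁ B₃` ([Balaban1985Variational] Prop 8, shared with LOWER) ⇒
  `∃ ε₁′ > 0, ∀ ε₀ ∈ (0, ε₁′], ∀ m ≥ 2, ∀ b₀ > 0, ∀ p₀, ∃ γ₁ > 0, ∀ F γ, F.L = L → 0 < γ ≤ γ₁ →
  RegularLiftAlongMinimisersAt F γ b₀ p₀ m ε₀ B₃ → UpperAlongRegPrMinimisersAt F γ b₀ p₀ m ε₀` (same radii, `K₀ := max K₀ 1`).
So, with `T3PrintedMinimiserExistence` and `T3LowerAlongMinimisersSplit`, the layer-3 stubs of the child read: EXIST = Thm 1 (8) ∧ G-K1aR-2;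
UPPER = Prop 8 ∧ G-K1a-2 (`RegularLiftAlongMinimisersAt`); LOWER = Prop 8 ∧ [Balaban1985Averaging] Prop 1 for (0.4) ∧ G-K1a-3a ∧ G-K1a-3b —
every printed input a named schema citing its locator, every unprinted statement a named located schema, all plumbing kernel-checked.

References: T. Bałaban, CMP 102 (1985) 277–309 [Balaban1985Variational] (Thm 1 (8)–(10) p.279, (13) p.280, Prop 8 p.304); CMP 98 (1985)
17–51 [Balaban1985Averaging] (Props 3–4, (125)); CMP 102 (1985) 255–275 [Balaban1985UV3] ((3)/(5) p.256); C. King, CMP 102 (1986) 649–677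
[King1986] (App. (A.5) p.676); P. Federbush, CMP 110 (1987) 293–309 [Federbush1987PhaseCellIII].
-/

noncomputable section

open MeasureTheory Filter Topology
open Literature.MathematicalPhysics.QuantumFieldTheory.Balaban1983to89.T3ContinuumYM3Torus
open Literature.MathematicalPhysics.QuantumFieldTheory.Balaban1983to89.T3UnitLawDensityEML (ℰp measurableE_ℰp)
open Literature.MathematicalPhysics.QuantumFieldTheory.Balaban1983to89.T3UnitScaleTilt
open Literature.MathematicalPhysics.QuantumFieldTheory.Balaban1983to89.T3TiltDescent
open Literature.MathematicalPhysics.QuantumFieldTheory.Balaban1983to89.T3ConstrainedMinimiser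
open Literature.MathematicalPhysics.QuantumFieldTheory.Balaban1983to89.T3DescentFibreTower
open Literature.MathematicalPhysics.QuantumFieldTheory.Balaban1983to89.T3MinimiserStabilityReduction
open Literature.MathematicalPhysics.QuantumFieldTheory.Balaban1983to89.T3RegularMinimiser
open Literature.MathematicalPhysics.QuantumFieldTheory.Balaban1983to89.T3PrintedRegularMinimiser
open Literature.MathematicalPhysics.QuantumFieldTheory.Balaban1983to89.T3PrintedRegularMinimiserReduction
open Literature.MathematicalPhysics.QuantumFieldTheory.Balaban1983to89.T3ThresholdSmallness (exists_forall_θBal_le)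
open Literature.MathematicalPhysics.QuantumFieldTheory.Balaban1983to89.T3LowerAlongMinimisersSplit
open Literature.MathematicalPhysics.QuantumFieldTheory.Balaban1983to89.Missing

namespace Literature.MathematicalPhysics.QuantumFieldTheory.Balaban1983to89.T3UpperAlongMinimisersSplit

/-! ## §1 A one-step lift of an element of the `(n,K)`-fibre lies in the `(n,K+1)`-fibre -/

section Lift

variable (F : T3Family)

/-- **FIBRE IDENTITY OF A ONE-STEP LIFT**: if `D_{K,K+1}U″ = U` and `U` lies in the `(n,K)`-fibre of `V`, then `U″` lies in the
`(n,K+1)`-fibre of `V` (descent tower `D_{n,K}∘D_{K,K+1} = D_{n,K+1}`, tree `T3DescentFibreTower.mem_fibre_trans`).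
[cite: Balaban1985Variational, (3) p.278] -/
theorem lift_mem_fibre {n K : ℕ} (hnK : n ≤ K) {V : GaugeField (F.P n) 0 (Matrix.specialUnitaryGroup (Fin 2) ℂ)}
    {U : GaugeField (F.P K) 0 (Matrix.specialUnitaryGroup (Fin 2) ℂ)} {U'' : GaugeField (F.P (K + 1)) 0 (Matrix.specialUnitaryGroup (Fin 2) ℂ)}
    (hlift : descendTo F ℰp K (K + 1) (Nat.le_succ K) U'' = U) (hU : U ∈ fibre F ℰp n K hnK V) :
    U'' ∈ fibre F ℰp n (K + 1) (hnK.trans (Nat.le_succ K)) V :=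
  mem_fibre_trans F ℰp hnK (Nat.le_succ K) (show U'' ∈ fibre F ℰp K (K + 1) (Nat.le_succ K) U from hlift) hU

/-- Hence an exact one-step lift which is printed-regular at run `K+1`'s cut-off lies in print's regular fibre (6) of run `K+1` over `V`.
[cite: Balaban1985Variational, (6) p.278] -/
theorem lift_mem_regFibrePr {n K : ℕ} (hnK : n ≤ K) {ε ε₀ : ℝ} {V : GaugeField (F.P n) 0 (Matrix.specialUnitaryGroup (Fin 2) ℂ)}
    {U : GaugeField (F.P K) 0 (Matrix.specialUnitaryGroup (Fin 2) ℂ)} {U'' : GaugeField (F.P (K + 1)) 0 (Matrix.specialUnitaryGroup (Fin 2) ℂ)}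
    (hU : U ∈ regFibrePr F n K hnK ε V) (hlift : descendTo F ℰp K (K + 1) (Nat.le_succ K) U'' = U) (hreg : RegPr F n (K + 1) ε₀ U'') :
    U'' ∈ regFibrePr F n (K + 1) (hnK.trans (Nat.le_succ K)) ε₀ V :=
  (mem_regFibrePr_iff F).mpr ⟨lift_mem_fibre F hnK hlift hU.1.1, hreg⟩

end Lift

/-! ## §2 The located schema G-K1a-2: exact one-step regular lifts of print's minimisers at `1/L` of the action -/

section Schema

/-- **LOCATED GAP G-K1a-2 AS A SCHEMA — REGULAR ONE-STEP LIFTS ALONG PRINT'S RUN-`K` MINIMISERS** (hypothesis, never asserted; NOT PRINTED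
for non-abelian fields): summable `r_K ≥ 0` and `K₀` such that for `K ≥ K₀`, every `θBal(⌊K/m⌋)`-small datum `V` and every minimiser `U`
of the Wilson action over print's space (6) of run `K` lying in (8) (radius `B₃θBal(⌊K/m⌋)`), there is a configuration `U″` on the finest
lattice of run `K+1` with (i) `D_{K,K+1}U″ = U` (exact one-step lift through the family's (0.4)-averaging), (ii) `U″ ∈ 𝔘_{K+1−n}(ε₀)` in
full (plaquette AND divergence clause at the finer cut-off), (iii) `β_{K+1}A(U″) ≤ β_K A(U) + r_K`, i.e. `L·A(U″) ≤ A(U) + r_K/β_K`.  The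
intended witness: a smooth interpolation of `U` (curvature spread uniformly, leading cost exactly `A(U)/L`) corrected to an exact lift by
the right inverse of the linearised averaging ([Balaban1985Averaging] Props 3–4, (125)); the error `Θ_K(U) = O(Σ|∇F|²) + O(F³) + O(F⁴)` is
summable along the printed minimiser by (9)–(10) p. 279 iff `m ≥ 3`.  Abelian template: [King1986] App. (A.5).
[cite: Balaban1985Variational, Thm 1 (9)-(10) p.279; King1986, (A.5) p.676] -/
def RegularLiftAlongMinimisersAt (F : T3Family) (γ b₀ p₀ : ℝ) (m : ℕ) (ε₀ B₃ : ℝ) : Prop :=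
  ∃ (K₀ : ℕ) (r : ℕ → ℝ), Summable r ∧ (∀ K, 0 ≤ r K) ∧
    ∀ K, K₀ ≤ K → ∀ (V : GaugeField (F.P (K / m)) 0 (Matrix.specialUnitaryGroup (Fin 2) ℂ)),
      PlaqSmall (θBal F.L γ b₀ p₀ (K / m)) V →
        ∀ U ∈ regFibrePr F (K / m) K (Nat.div_le_self K m) (B₃ * θBal F.L γ b₀ p₀ (K / m)) V,
          IsMinOn (fun W : GaugeField (F.P K) 0 (Matrix.specialUnitaryGroup (Fin 2) ℂ) => wilsonAction4 W)
              (regFibrePr F (K / m) K (Nat.div_le_self K m) ε₀ V) U →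
            ∃ U'' : GaugeField (F.P (K + 1)) 0 (Matrix.specialUnitaryGroup (Fin 2) ℂ),
              descendTo F ℰp K (K + 1) (Nat.le_succ K) U'' = U ∧ RegPr F (K / m) (K + 1) ε₀ U'' ∧
                (F.scheme ℰp γ).β (K + 1) * wilsonAction4 U'' ≤ (F.scheme ℰp γ).β K * wilsonAction4 U + r K

end Schema

/-! ## §3 The composition: UPPER ⇐ [7] Prop 8 ∧ G-K1a-2, under the route's prefix -/

section Composition

/-- **UPPER ⇐ THE SPLIT, UNDER THE ROUTE'S PREFIX.**  Given [Balaban1985Variational] Prop 8 for the family at constants `a₀, a₁, B₃ > 0`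
(`T3LowerAlongMinimisersSplit.MinimisersIn8At`: minimisers over (6) lie in (8)), there is `ε₁′ > 0` (namely `a₀`) such that for every
`0 < ε₀ ≤ ε₁′`, `m ≥ 2`, `b₀ > 0`, real `p₀` there is `γ₁ > 0` such that for all `F` with `F.L = L` and `0 < γ ≤ γ₁`: the regular-lift
schema G-K1a-2 (`RegularLiftAlongMinimisersAt F γ b₀ p₀ m ε₀ B₃`) implies the stub `UpperAlongRegPrMinimisersAt F γ b₀ p₀ m ε₀`, with the
same radii and `K₀ := max K₀ 1`; `γ₁` puts `θBal(i) ≤ min a₁ (ε₀/B₃)` at every height (`T3ThresholdSmallness.exists_forall_θBal_le`), so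
that (7) and the window `B₃ε₁ ≤ ε₀ ≤ a₀` of Prop 8 hold with `ε₁ = θBal(⌊K/m⌋)`; `m ≥ 2` gives `⌊K/m⌋ < K`.
[cite: Balaban1985Variational, Thm 1 (8)-(10) p.279 and Prop 8 p.304] -/
theorem upperAlongRegPrMinimisersAt_of_split {L : ℕ} {a₀ a₁ B₃ : ℝ} (ha₀ : 0 < a₀) (ha₁ : 0 < a₁) (hB₃ : 0 < B₃)
    (h8 : MinimisersIn8At L a₀ a₁ B₃) :
    ∃ ε₁' : ℝ, 0 < ε₁' ∧ ∀ ε₀ : ℝ, 0 < ε₀ → ε₀ ≤ ε₁' → ∀ m : ℕ, 2 ≤ m → ∀ b₀ p₀ : ℝ, 0 < b₀ →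
      ∃ γ₁ : ℝ, 0 < γ₁ ∧ ∀ (F : T3Family) (γ : ℝ), F.L = L → 0 < γ → γ ≤ γ₁ →
        RegularLiftAlongMinimisersAt F γ b₀ p₀ m ε₀ B₃ → UpperAlongRegPrMinimisersAt F γ b₀ p₀ m ε₀ := by
  refine ⟨a₀, ha₀, fun ε₀ hε₀ hε₀a m hm b₀ p₀ hb => ?_⟩
  by_cases hL : 1 ≤ L
  · have hσ : 0 < min a₁ (ε₀ / B₃) := lt_min ha₁ (div_pos hε₀ hB₃)
    obtain ⟨γ₁, hγ₁, hθ⟩ := exists_forall_θBal_le hL b₀ p₀ hσ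
    refine ⟨min γ₁ 1, lt_min hγ₁ one_pos, fun F γ hF hγ hγle hlift => ?_⟩
    have hγ₁' : γ ≤ γ₁ := hγle.trans (min_le_left _ _)
    have hγ1 : γ ≤ 1 := hγle.trans (min_le_right _ _)
    obtain ⟨K₀, r, hr, hr0, hlift⟩ := hlift
    refine ⟨max K₀ 1, r, hr, hr0, fun K hK V hV U hU hUmin => ?_⟩
    have hK₀ : K₀ ≤ K := (le_max_left _ _).trans hK
    have hK1 : 1 ≤ K := (le_max_right _ _).trans hK
    have hnK : K / m < K := Nat.div_lt_self (by omega) (by omega)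
    -- `ε₁ := θBal(n)`: positive, `≤ a₁`, `B₃ε₁ ≤ ε₀`
    have hFL : 1 ≤ F.L := F.hL.2.le
    have hε₁ : 0 < θBal F.L γ b₀ p₀ (K / m) := θBal_pos hFL hγ hγ1 hb p₀ (K / m)
    have hθle : θBal F.L γ b₀ p₀ (K / m) ≤ min a₁ (ε₀ / B₃) := by rw [hF]; exact hθ γ hγ hγ₁' (K / m)
    have hε₁a : θBal F.L γ b₀ p₀ (K / m) ≤ a₁ := hθle.trans (min_le_left _ _)
    have hlo : B₃ * θBal F.L γ b₀ p₀ (K / m) ≤ ε₀ := by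
      have h := mul_le_mul_of_nonneg_left (hθle.trans (min_le_right _ _)) hB₃.le
      rwa [mul_div_cancel₀ _ hB₃.ne'] at h
    -- the stub's minimiser minimises in the `IsMinOn` sense, hence lies in (8) by Prop 8
    have hmin := isMinOn_of_eq_minActionRegPr F hUmin
    have hU8 : U ∈ regFibrePr F (K / m) K (Nat.div_le_self K m) (B₃ * θBal F.L γ b₀ p₀ (K / m)) V :=
      h8 F hF (K / m) K hnK _ ε₀ hε₁ hε₁a hlo hε₀a V hV U hU hmin
    -- the competitor: the regular one-step lift
    obtain ⟨U'', hD, hreg, hineq⟩ := hlift K hK₀ V hV U hU8 hmin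
    exact ⟨U'', lift_mem_regFibrePr F (Nat.div_le_self K m) hU8 hD hreg, hineq⟩
  · -- no member of the family has block size `L < 1`
    refine ⟨1, one_pos, fun F γ hF _ _ _ => ?_⟩
    exact absurd (hF ▸ F.hL.2.le) hL

/-- **LAYER 3 OF THE CHILD AT PRINT'S REGULAR BACKGROUND, FROM THE NAMED PIECES** — for ONE family and coupling at which all route-style
schemas hold: EXIST (`HasRegMinimisersPrAt`) ∧ the regular-lift schema (⇒ UPPER) ∧ the averaging schemas (⇒ LOWER) ⇒
`MinimiserStabilityRegPrAt F γ b₀ p₀ m ε₀` — the tree's reduction `minimiserStabilityRegPrAt_of_alongRegPrMinimisers` fed with the two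
splits (hypotheses already specialised to `F`, `γ`; `γ ≥ 0`). [cite: King1986, App. (A.5) p.676] -/
theorem minimiserStabilityRegPrAt_of_pieces {F : T3Family} {γ b₀ p₀ : ℝ} {m : ℕ} {ε₀ B₃ : ℝ} (hγ : 0 ≤ γ)
    (hex : HasRegMinimisersPrAt F γ b₀ p₀ m ε₀)
    (hup : RegularLiftAlongMinimisersAt F γ b₀ p₀ m ε₀ B₃ → UpperAlongRegPrMinimisersAt F γ b₀ p₀ m ε₀)
    (hlow : AvgActionIneqAt F γ b₀ p₀ m ε₀ B₃ → LowerAlongRegPrMinimisersAt F γ b₀ p₀ m ε₀)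
    (hlift : RegularLiftAlongMinimisersAt F γ b₀ p₀ m ε₀ B₃) (havg : AvgActionIneqAt F γ b₀ p₀ m ε₀ B₃) :
    MinimiserStabilityRegPrAt F γ b₀ p₀ m ε₀ :=
  minimiserStabilityRegPrAt_of_alongRegPrMinimisers hγ hex (hup hlift) (hlow havg)

end Composition

end Literature.MathematicalPhysics.QuantumFieldTheory.Balaban1983to89.T3UpperAlongMinimisersSplit

end
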